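import Summits.QuantumFields.BalabanUV.T4Continuum.Spine.NE1p.DressedRootFam
import Summits.QuantumFields.BalabanUV.T4Continuum.Spine.NE1p.DressedBirthSuppliers
import Summits.QuantumFields.BalabanUV.T4Continuum.Support.NE1pFamilyBudgetFn

/-!
# T⁴ programme, spine estimate NE1′ (node O3b/H2) — LEAF L-B FOR THE FAMILY DOOR: THE BIRTH SUPPLIER OF END-B-fam UNDER THE
# FAMILY-DRESSED BUDGET GATE (crew row S5 of the NE1′ formalisation swarm, «S5-fam»; companion of `Spine/NE1p/DressedBirthSuppliers`)

Cell `pub-balaban`, sub-cell `t4`, BINDER-OWNERS row NE1′ (owner lineage t4-ne1p-p1, skeleton `t4/skeletons/NE1p-t4-ne1p-p1.md`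
v1.1 §1 ROOT-B ∕ END-B-fam, §2 leaf L-B); swarm unit `b2b-balaban-t4-ne1p-formalise-leaf-05`; tree target
`Summits/QuantumFields/BalabanUV/T4Continuum/Spine/NE1p/`; ADDITIVE — imports `Spine/NE1p/DressedRootFam`, `Spine/NE1p/DressedBirthSuppliers`
and `Support/NE1pFamilyBudgetFn` ONLY, modifies nothing.

WHAT THIS FILE DOES.  END-B-fam (`DressedRootFam.dressedBudget_of_familyLeaves`, the door-neutral END of ROOT-B) consumes the
family-format leaf bundle `BookingLeavesFam U Bk T`, whose birth field is
  `hbirth : BirthsFromOldFam T C ρ σ (budgetGateFam T s₀ U.m S C ρ)`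
— history-sourced births with FAMILY birth constants `C b`, FAMILY classes `σ b k` (dominated by a HISTORY WEIGHT `H b` times the
uniform two-rate class, field `hσ`) and the WEIGHTED positional count of the live families (field `hcountH`).  Here that field is
CONCLUDED VERBATIM from the family absorption format of `NE1pFamilyBudgetFn` §4b («met steps as births — a family absorption
constant, paid once per offspring»):
* `absorbedClassesFam_le` — the absorbed (strictly older, LIVE) families' classes at the offspring's birth scale `j` sum to at most
  `N₀·A₀·(1−ρ′)⁻¹·τ^{K−j}`: the bundle's own `hσ` and `hcountH` and the strict product `Λρ₁τ ≤ ρ′ < 1` (the weighted age-sum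
  regrouping of `NE1pFamilyBudget.budgetGateFam_of_envBound`, `freshProfile_inner_le` BY NAME);
* `hbirthFam_of_absorbsFromFam_live` — `AbsorbsFromFam T C ρ β A Sabs (budgetGateFam …)` + absorbed ⊆ live + `0 ≤ A b ≤ Ā` +
  dressing sizes `β j ≤ β₀·τ^{K−j}` + the DIAGONAL ROOM of the offspring's class `(β₀ + Ā·N₀·A₀·(1−ρ′)⁻¹)·τ^{K−j_b} ≤ σ b j_b`
  ⟹ `hbirth` (`birthsFromOldFam_of_absorbsFromFam` BY NAME);
* `hbirthFam_of_absorbsFromFam_weighted` — the door-2 classes `σ b k := H b·(A₀ρ₁^{k−j_b}τ^{K−j_b})` EXACTLY: the room reads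
  `β₀ + Ā·N₀·A₀·(1−ρ′)⁻¹ ≤ H b·A₀` — «the OFFSPRING's history weight pays the absorbed mass»; with `H ≡ 1` this is the (w5b)
  smallness of doors 1∕3 (`DressedBirthSuppliers.hbirth_of_absorbsFrom_live` through `BookingLeaves.toFam`).
Which door the cell takes (history price in `C b` at birth, in weights `H b`, or uniform) is the owner's ∕ the WALL's («which door»,
`t4/ideate/NE1p-WALL.md` §5); this file wires the birth slot for the weighted door and asserts nothing.

HONEST FRAMING.  [folklore] kernel bookkeeping over HYPOTHESIS SHAPES; 0 sorry; 0 citations used as facts; NO `def … : Prop` minted;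
nothing of Bałaban's densities or the cell's D-terms is asserted — the absorption constants `A b`, the dressing sizes, the history
weights and the diagonal room are DISPLAYED BINDERS ((w1)+(w5b); printed CONTEXT only: [Balaban1989LargeFieldII] (1.69) p. 377
«budgets add»).  Headline: «L-B (family door) ⇐ the named binders», NEVER «NE1′ proved»; NE1′ NOT PRINTED, NOT PROVED; 0 binders
instantiated on Bałaban's densities; spine PROVED 0∕9 unchanged.  Rung (B)+1 on ONE finite four-torus — NOT infinite volume, NOT a
mass gap, NOT the Clay problem, NOT summit progress.  HONEST DEPENDENCY: continuum YM on T⁴ ⇐ BetaPertH ∧ nine spine estimates (0/9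
proved); BetaPertH ⇐ (D1) ∧ (D4) ∧ CAP+tail; G-an2-4 gates asym, D1 and NE2/3/4.
-/

noncomputable section

namespace Summit.QuantumFields.BalabanUV.T4Continuum.NE1p.DressedBirthSuppliers

open Finset
open scoped BigOperators
open Literature.MathematicalPhysics.QuantumFieldTheory.Balaban1983to89
open Literature.MathematicalPhysics.QuantumFieldTheory.Balaban1983to89.T4TermFormat
open Literature.MathematicalPhysics.QuantumFieldTheory.Balaban1983to89.T4TermFormat.Booking
open Literature.MathematicalPhysics.QuantumFieldTheory.Balaban1983to89.T4TrajectoryComparison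
open Summit.QuantumFields.BalabanUV.T4Continuum.T4TrajectoryDensityDressed
open Summit.QuantumFields.BalabanUV.T4Continuum.NE1pFamilyBudget
open Summit.QuantumFields.BalabanUV.T4Continuum.NE1p.DressedRoot

variable {Bk : T4TermFormat.Booking} {T : Trajectory Bk}

/-! ## §1 The absorbed classes under the weighted positional count -/

/-- **THE ABSORBED CLASSES SUM UNDER THE WEIGHTED COUNT**: at a scale `j ≤ K`, a finset `Sabs` of families born STRICTLY before
`j` and contained in the live families `Slive` of the met component, family classes dominated by history weights times the uniform
class (`σ f j ≤ H f·A₀ρ₁^{j−j_f}τ^{K−j_f}`, the `BookingLeavesFam.hσ` field at scale `j`), nonnegative weights, the WEIGHTED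
positional count of the live families (`Σ_{f ∈ Slive, j_f = j₀} H f ≤ N₀Λ^{j−j₀}`, the `hcountH` field at scale `j`) and the strict
product `Λρ₁τ ≤ ρ′ < 1` give `Σ_{f ∈ Sabs} σ f j ≤ N₀·A₀·(1−ρ′)⁻¹·τ^{K−j}` — the absorbed classes of age `m` weigh `(ρ₁τ)^m`
against their weighted number `Λ^m` (`freshProfile_inner_le` BY NAME). [folklore] -/
theorem absorbedClassesFam_le {H : Bk.Birth → ℝ} {σ : Bk.Birth → ℕ → ℝ} {Sabs Slive : Finset Bk.Birth}
    {A₀ ρ₁ τ Λ N₀ ρ' : ℝ} {j : ℕ}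
    (hA₀ : 0 ≤ A₀) (hρ₁ : 0 ≤ ρ₁) (hτ0 : 0 ≤ τ) (hΛ : 0 ≤ Λ) (hN₀ : 0 ≤ N₀) (hρ'1 : ρ' < 1)
    (hprod : Λ * ρ₁ * τ ≤ ρ') (hj : j ≤ Bk.K) (holder : ∀ f ∈ Sabs, Bk.birthScale f < j) (hsub : Sabs ⊆ Slive)
    (hH : ∀ f, 0 ≤ H f)
    (hcountH : ∀ j₀ ≤ j, ∑ f ∈ Slive.filter (fun f => Bk.birthScale f = j₀), H f ≤ N₀ * Λ ^ (j - j₀))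
    (hσ : ∀ f ∈ Sabs, σ f j ≤ H f * (A₀ * ρ₁ ^ (j - Bk.birthScale f) * τ ^ (Bk.K - Bk.birthScale f))) :
    ∑ f ∈ Sabs, σ f j ≤ N₀ * A₀ * (1 - ρ')⁻¹ * τ ^ (Bk.K - j) := by
  classical
  set g : ℕ → ℝ := fun j₀ => A₀ * ρ₁ ^ (j - j₀) * τ ^ (Bk.K - j₀) with hg
  have hg0 : ∀ j₀, 0 ≤ g j₀ := fun j₀ => by rw [hg]; positivity
  have hregroup : ∑ f ∈ Sabs, H f * g (Bk.birthScale f) =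
      ∑ j₀ ∈ range (j + 1), (∑ f ∈ Sabs.filter (fun f => Bk.birthScale f = j₀), H f) * g j₀ := by
    rw [← sum_fiberwise_of_maps_to (s := Sabs) (t := range (j + 1)) (g := Bk.birthScale)
      (fun f hf => mem_range_succ_iff.mpr (holder f hf).le) (fun f => H f * g (Bk.birthScale f))]
    refine sum_congr rfl fun j₀ _ => ?_
    rw [sum_mul]
    refine sum_congr rfl fun f hf => ?_
    rw [(mem_filter.mp hf).2]
  have hfilter : ∀ j₀, ∑ f ∈ Sabs.filter (fun f => Bk.birthScale f = j₀), H f ≤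
      ∑ f ∈ Slive.filter (fun f => Bk.birthScale f = j₀), H f := fun j₀ =>
    sum_le_sum_of_subset_of_nonneg (filter_subset_filter _ hsub) fun f _ _ => hH f
  have hinner := freshProfile_inner_le (N₀ := N₀) (cδ := 1) (Ahat := A₀) (Λ := Λ) (φ := ρ₁) (τ := τ) (ρ := ρ')
    hN₀ zero_le_one hA₀ hΛ hρ₁ hτ0 hρ'1 hprod hj
  calc ∑ f ∈ Sabs, σ f j ≤ ∑ f ∈ Sabs, H f * g (Bk.birthScale f) :=
        sum_le_sum fun f hf => (hσ f hf).trans (by rw [hg])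
    _ = ∑ j₀ ∈ range (j + 1), (∑ f ∈ Sabs.filter (fun f => Bk.birthScale f = j₀), H f) * g j₀ := hregroup
    _ ≤ ∑ j₀ ∈ range (j + 1), N₀ * Λ ^ (j - j₀) * g j₀ :=
        sum_le_sum fun j₀ hj₀ => mul_le_mul_of_nonneg_right
          ((hfilter j₀).trans (hcountH j₀ (mem_range_succ_iff.mp hj₀))) (hg0 j₀)
    _ = ∑ j₀ ∈ range (j + 1), N₀ * Λ ^ (j - j₀) * (1 * ρ₁ ^ (j - j₀)) * (A₀ * τ ^ (Bk.K - j₀)) := by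
        refine sum_congr rfl fun j₀ _ => ?_
        rw [hg]
        ring
    _ ≤ N₀ * 1 * A₀ * (1 - ρ')⁻¹ * τ ^ (Bk.K - j) := hinner
    _ = N₀ * A₀ * (1 - ρ')⁻¹ * τ ^ (Bk.K - j) := by ring

/-! ## §2 The family birth field from the family absorption format -/

/-- **LEAF L-B FOR THE FAMILY DOOR — the field `BookingLeavesFam.hbirth` VERBATIM**: with the uniform constants `U`, family
absorption births UNDER THE FAMILY-DRESSED GATE `AbsorbsFromFam T C ρ β A Sabs (budgetGateFam T s₀ U.m S C ρ)` (own dressing size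
`β j_b` plus the FAMILY absorption constant `A b` times the envelopes of the absorbed families), absorbed families strictly older and
among the live families `S (j_b) b` of the met component, the bundle's own field types `hcountH` (weighted positional count) and
`hσ` (classes below `H f ×` the uniform class), nonnegative weights, `0 ≤ A b ≤ Ā`, dressing sizes `β j ≤ β₀·U.τ^{K−j}`, and the
DIAGONAL ROOM of the offspring's own class `(β₀ + Ā·U.N₀·U.A₀·(1−U.ρ′)⁻¹)·U.τ^{K−j_b} ≤ σ b j_b` ⟹
`BirthsFromOldFam T C ρ σ (budgetGateFam T s₀ U.m S C ρ)` (`birthsFromOldFam_of_absorbsFromFam` BY NAME). [folklore] -/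
theorem hbirthFam_of_absorbsFromFam_live (U : UniformConstants) (T : Trajectory Bk) (C H : Bk.Birth → ℝ)
    (ρ σ : Bk.Birth → ℕ → ℝ) (s₀ : Bk.Birth → ℕ → ℝ) (S : ℕ → Bk.Birth → Finset Bk.Birth)
    {Sabs : Bk.Birth → Finset Bk.Birth} {β : ℕ → ℝ} {A : Bk.Birth → ℝ} {Abar β₀ : ℝ}
    (holder : ∀ b b₀, b₀ ∈ Sabs b → Bk.birthScale b₀ < Bk.birthScale b)
    (hsub : ∀ b, Sabs b ⊆ S (Bk.birthScale b) b) (hH : ∀ f, 0 ≤ H f)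
    (hcountH : ∀ k b, ∀ j ≤ k, ∑ f ∈ (S k b).filter (fun f => Bk.birthScale f = j), H f ≤ U.N₀ * U.Λ ^ (k - j))
    (hσ : ∀ f k, Bk.birthScale f ≤ k → k ≤ Bk.K →
      σ f k ≤ H f * (U.A₀ * U.ρ₁ ^ (k - Bk.birthScale f) * U.τ ^ (Bk.K - Bk.birthScale f)))
    (hA : ∀ b, 0 ≤ A b) (hAbar : ∀ b, A b ≤ Abar)
    (habs : AbsorbsFromFam T C ρ β A Sabs (budgetGateFam T s₀ U.m S C ρ))
    (hβ : ∀ j, j ≤ Bk.K → β j ≤ β₀ * U.τ ^ (Bk.K - j))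
    (hroom : ∀ b, Bk.birthScale b ≤ Bk.K →
      (β₀ + Abar * U.N₀ * U.A₀ * (1 - U.ρ')⁻¹) * U.τ ^ (Bk.K - Bk.birthScale b) ≤ σ b (Bk.birthScale b)) :
    BirthsFromOldFam T C ρ σ (budgetGateFam T s₀ U.m S C ρ) := by
  refine birthsFromOldFam_of_absorbsFromFam holder hA habs fun b hbK => ?_
  have hY0 : 0 ≤ U.N₀ * U.A₀ * (1 - U.ρ')⁻¹ * U.τ ^ (Bk.K - Bk.birthScale b) := by
    have : 0 ≤ (1 - U.ρ')⁻¹ := inv_nonneg.mpr (by linarith [U.hρ'1])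
    have := U.hN₀; have := U.hA₀; have := U.hτ0
    positivity
  have hsum : ∑ b₀ ∈ Sabs b, σ b₀ (Bk.birthScale b) ≤
      U.N₀ * U.A₀ * (1 - U.ρ')⁻¹ * U.τ ^ (Bk.K - Bk.birthScale b) :=
    absorbedClassesFam_le U.hA₀ U.hρ₁ U.hτ0 U.hΛ U.hN₀ U.hρ'1 U.hprod hbK (fun f hf => holder b f hf) (hsub b) hH
      (hcountH (Bk.birthScale b) b) (fun f hf => hσ f _ (holder b f hf).le hbK)
  calc β (Bk.birthScale b) + A b * ∑ b₀ ∈ Sabs b, σ b₀ (Bk.birthScale b)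
      ≤ β₀ * U.τ ^ (Bk.K - Bk.birthScale b) + A b * (U.N₀ * U.A₀ * (1 - U.ρ')⁻¹ * U.τ ^ (Bk.K - Bk.birthScale b)) :=
        add_le_add (hβ _ hbK) (mul_le_mul_of_nonneg_left hsum (hA b))
    _ ≤ β₀ * U.τ ^ (Bk.K - Bk.birthScale b) + Abar * (U.N₀ * U.A₀ * (1 - U.ρ')⁻¹ * U.τ ^ (Bk.K - Bk.birthScale b)) :=
        add_le_add le_rfl (mul_le_mul_of_nonneg_right (hAbar b) hY0)
    _ = (β₀ + Abar * U.N₀ * U.A₀ * (1 - U.ρ')⁻¹) * U.τ ^ (Bk.K - Bk.birthScale b) := by ring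
    _ ≤ σ b (Bk.birthScale b) := hroom b hbK

/-- **THE DOOR-2 CLASSES — `BookingLeavesFam.hbirth` VERBATIM WITH THE HISTORY WEIGHT PAYING**: for the family classes
`σ b k := H b·(A₀ρ₁^{k−j_b}τ^{K−j_b})` EXACTLY (so the bundle's `hσ` holds with equality), the diagonal room of
`hbirthFam_of_absorbsFromFam_live` reads `β₀ + Ā·N₀·A₀·(1−ρ′)⁻¹ ≤ H b·A₀` for every family `b`: the OFFSPRING's history weight
pays for the absorbed mass (with `H ≡ 1` this is the (w5b) smallness of the uniform door).  Conclusion VERBATIM the field type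
at these classes. [folklore] -/
theorem hbirthFam_of_absorbsFromFam_weighted (U : UniformConstants) (T : Trajectory Bk) (C H : Bk.Birth → ℝ)
    (ρ : Bk.Birth → ℕ → ℝ) (s₀ : Bk.Birth → ℕ → ℝ) (S : ℕ → Bk.Birth → Finset Bk.Birth)
    {Sabs : Bk.Birth → Finset Bk.Birth} {β : ℕ → ℝ} {A : Bk.Birth → ℝ} {Abar β₀ : ℝ}
    (holder : ∀ b b₀, b₀ ∈ Sabs b → Bk.birthScale b₀ < Bk.birthScale b)
    (hsub : ∀ b, Sabs b ⊆ S (Bk.birthScale b) b) (hH : ∀ f, 0 ≤ H f)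
    (hcountH : ∀ k b, ∀ j ≤ k, ∑ f ∈ (S k b).filter (fun f => Bk.birthScale f = j), H f ≤ U.N₀ * U.Λ ^ (k - j))
    (hA : ∀ b, 0 ≤ A b) (hAbar : ∀ b, A b ≤ Abar)
    (habs : AbsorbsFromFam T C ρ β A Sabs (budgetGateFam T s₀ U.m S C ρ))
    (hβ : ∀ j, j ≤ Bk.K → β j ≤ β₀ * U.τ ^ (Bk.K - j))
    (hpay : ∀ b, β₀ + Abar * U.N₀ * U.A₀ * (1 - U.ρ')⁻¹ ≤ H b * U.A₀) :
    BirthsFromOldFam T C ρ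
      (fun b k => H b * (U.A₀ * U.ρ₁ ^ (k - Bk.birthScale b) * U.τ ^ (Bk.K - Bk.birthScale b)))
      (budgetGateFam T s₀ U.m S C ρ) := by
  refine hbirthFam_of_absorbsFromFam_live U T C H ρ _ s₀ S holder hsub hH hcountH (fun f k _ _ => le_rfl) hA hAbar habs hβ
    fun b _ => ?_
  have hτp : 0 ≤ U.τ ^ (Bk.K - Bk.birthScale b) := pow_nonneg U.hτ0 _
  calc (β₀ + Abar * U.N₀ * U.A₀ * (1 - U.ρ')⁻¹) * U.τ ^ (Bk.K - Bk.birthScale b)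
      ≤ (H b * U.A₀) * U.τ ^ (Bk.K - Bk.birthScale b) := mul_le_mul_of_nonneg_right (hpay b) hτp
    _ = H b * (U.A₀ * U.ρ₁ ^ (Bk.birthScale b - Bk.birthScale b) * U.τ ^ (Bk.K - Bk.birthScale b)) := by
        rw [Nat.sub_self, pow_zero, mul_one]; ring

/-- **CONSISTENCY WITH THE UNIFORM DOOR**: with unit weights `H ≡ 1`, constant data `C`, `ρ`, `A` and the uniform classes, the
family birth field IS the uniform one — `DressedBirthSuppliers.hbirth_of_absorbsFrom_live` through `birthsFromOldFam_const_iff`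
(the tree's `BookingLeaves.toFam` embedding); recorded as an `example` so the two doors are seen to agree. [folklore] -/
example (U : UniformConstants) (T : Trajectory Bk) (ρ : ℕ → ℝ) (s₀ : Bk.Birth → ℕ → ℝ) (S : ℕ → Bk.Birth → Finset Bk.Birth)
    {Sabs : Bk.Birth → Finset Bk.Birth} {β : ℕ → ℝ} {A β₀ : ℝ}
    (holder : ∀ b b₀, b₀ ∈ Sabs b → Bk.birthScale b₀ < Bk.birthScale b) (hsub : ∀ b, Sabs b ⊆ S (Bk.birthScale b) b)
    (hcountS : ∀ k b, ∀ j ≤ k, (((S k b).filter fun f => Bk.birthScale f = j).card : ℝ) ≤ U.N₀ * U.Λ ^ (k - j))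
    (hA : 0 ≤ A) (habs : T.AbsorbsFrom U.C ρ β A Sabs (budgetGate T s₀ U.m S U.C ρ))
    (hβ : ∀ j, j ≤ Bk.K → β j ≤ β₀ * U.τ ^ (Bk.K - j)) (hsmall : β₀ + A * U.N₀ * U.A₀ * (1 - U.ρ')⁻¹ ≤ U.A₀) :
    BirthsFromOldFam T (fun _ => U.C) (fun _ => ρ) (fun b k => twoRate U.A₀ U.ρ₁ U.τ Bk.K (Bk.birthScale b) k)
      (budgetGateFam T s₀ U.m S (fun _ => U.C) fun _ => ρ) :=
  birthsFromOldFam_const_iff.mpr (hbirth_of_absorbsFrom_live U T ρ s₀ S holder hsub hcountS hA habs hβ hsmall)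

end Summit.QuantumFields.BalabanUV.T4Continuum.NE1p.DressedBirthSuppliers

end
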